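/-
Copyright (c) 2026 the pub-hodgecm-mathlib formalisation cell (harness21).  Prover seat hodgecm-mathlib-K2Liu-p03 (g8), Track B «K2-LIT»,
#184♮ = hLiu418 = `stmt-HodgeConjecture-24832`; socket #41, KIND 1 — (K1a-T) brick (C-a): ★ p863366 (K1a-2d) ED. 3 §3 RE-RUN WITH ITS EXCEPTIONAL SET SPLIT as
`T_rec ∪ {v : ¬ |ι_v τ|_v ≤ 1}` with `T_rec` INDEPENDENT OF THE TWIST `σ` — the transparency the (L1)∕(L4)∕(L5) count letters of ★ p863488 need (K1a desk K2E5-p16 (g8)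
01:10:41Z; this seat's ruling request 2026-09-05T01:20Z).  THEOREMS ONLY (no `def`, no `instance`, no notation, no named-fact hypothesis, no `sorry`).
-/
import Summits.HodgeConjecture.HodgeConjecture.Theorems.K2LiuRankOneSingularLocalValueCMRecord   -- ★ p863366 (K2E3-p37 (g3)): §1 dictionary, §2 `integral_conjChar_single_mul_weylDelta_eq_of_isGoodPlace`, §3 the `∃ T₀(σ)` head
import HarnessLib

/-!
# Crux `HLiu418`, socket #41 KIND 1 a♮ — (K1a-T)(C-a) `K2LiuRankOneSingularLocalValueCMRecordSplit`: ★ p863366's COFINITE VALUE LETTER WITH A `σ`-INDEPENDENT EXCEPTIONAL SET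
# `∃ T_rec, ∀ σ (τ ≠ 0), ∀ v ∉ T_rec, |ι_v τ|_v ≤ 1 → ∫ conj ψ_{σE₁₁}(ι_v y) Λ_{s,v}((w_Δ)_v y) dν = c¹_v(s) · Σ_{k ≤ ord_v τ}(ε_v q_v^{1−2s})^k`

Cell `hodgecm-mathlib`, crux item hLiu418 = `stmt-HodgeConjecture-24832` (helper lane `--supports … --as helper`, count-neutral), route of record `HCCMUnconditional`;
squad K2 ∕ K2Liu, road `K2_Liu`, socket #41, KIND 1, block K1-a♮.

WHY.  ★ p863366 `exists_finset_forall_integral_conjChar_lambdaLoc_weylDelta_eq_localScalarK1_of_record` states `∃ T₀, ∀ v ∉ T₀, …` with `T₀ = T₀(σ)` depending on the twist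
`σ` and carrying NO size information; the K1-a♮ tail (★ p863805 ∕ ★ p864019 FILE W) puts `T₀(σc S)` INTO its head set `T S h`, and ★ p863488's count letters ((L4)'s
`(16∕3)^{#Pm S h}`, ★ p864035) must bound `#T S h` in terms of `S`.  Its proof already splits `T₀(σ) = T₁ ∪ T₂ ∪ T₃(τ)` with `T₁` (★ `exists_finset_forall_placeLetters_cm`,
frame letters) and `T₂` (★ `exists_finset_forall_record_letters`) INDEPENDENT of `σ`, and `T₃(τ) = {v : ¬ |ι_v τ|_v ≤ 1}` the DENOMINATORS of `τ = t₁·Tr_{L∕L⁺}(σδ)` — a set the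
arithmetic can count (`ω(den τ)`).  THIS FILE re-runs that proof with the split in the STATEMENT:
* **`exists_recordFinset_forall_integral_conjChar_lambdaLoc_weylDelta_eq`** — `∃ T_rec` (a finite set of places of `L⁺`, depending on the datum and `lam` ONLY) such that for EVERY
  `σ` with `τ(σ) ≠ 0`, every `v ∉ T_rec` AT WHICH `τ` IS INTEGRAL (`Valued.v (ι_v τ) ≤ 1`), every normalised Haar `ν` on `N_Δ(L⁺_v)` and every `1 < re s`, ★ p863366's value identity
  holds (same bytes).  Proof = ★ p863366 §3's lines with `hT₃ v hv₃` replaced by the hypothesis.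
HONEST LABEL.  Count-neutral helper (a restatement for transparency; no new mathematics); it closes no socket: `HC_CM` is proved only modulo the 7 printed citations (2 remaining
named inputs: hLiu418 = `stmt-HodgeConjecture-24832`, h413 = `stmt-HodgeConjecture-24833`) until rung 0 closes.

## References
* [KudlaRallis1994] S. Kudla, S. Rallis, *A regularized Siegel–Weil formula: the first term identity*, Ann. of Math. 140 (1994), §2.
* [Shimura1997] G. Shimura, *Euler Products and Eisenstein Series*, CBMS 93 (1997), §18.4.
* [Tan1999] V. Tan, *Poles of Siegel Eisenstein series on U(n,n)*, Canad. J. Math. 51 (1999), §3, §4 Prop. 4.8.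
* [HarrisKudlaSweet1996] M. Harris, S. Kudla, W. J. Sweet, J. AMS 9 (1996), §6 (6.14)–(6.16).
-/

set_option autoImplicit false
set_option linter.dupNamespace false -- the mandated namespace repeats `HodgeConjecture.HodgeConjecture`

noncomputable section

open scoped NNReal ENNReal ComplexConjugate
open NumberField IsDedekindDomain Matrix MeasureTheory
open Literature.NumberTheory.GaloisRepresentations.IsNonarchimedeanLocalField
open Literature.NumberTheory.Automorphic Literature.NumberTheory.Automorphic.UnitaryGroup Literature.NumberTheory.GaloisRepresentations
open Literature.NumberTheory.GelbartRogawski1991 Literature.NumberTheory.GelbartRogawski1991.GRConstruction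
open Literature.NumberTheory.GelbartRogawski1991.AdaptedBlocks
open Literature.NumberTheory.GelbartRogawski1991.UnitaryDualPair Literature.NumberTheory.GelbartRogawski1991.UnitaryDualPair.LocalSplitting
open Literature.NumberTheory.K2Lit Literature.NumberTheory.K2Lit.SiegelDoubled Literature.NumberTheory.K2Lit.LocalSiegelDoubled
open Literature.Topology.Algebra.RestrictedProduct (inH)
open Summit.HodgeConjecture.HodgeConjecture.Cruxes.HLiu418.K2LiuSiegelUnipotentLocalDefs
open Summit.HodgeConjecture.HodgeConjecture.Cruxes.HLiu418.K2LiuSiegelUnipotentFourierDefs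
open Summit.HodgeConjecture.HodgeConjecture.Cruxes.HLiu418.K2LiuSiegelUnipotentCharacters
open Summit.HodgeConjecture.HodgeConjecture.Cruxes.HLiu418.K2LiuLocalLFactorDefs
open Summit.HodgeConjecture.HodgeConjecture.Cruxes.HLiu418.K2LiuRankOneSingularLocalValueCM (integral_conjChar_lambdaLoc_weylDelta_eq_one_of_forall)
open Summit.HodgeConjecture.HodgeConjecture.Cruxes.HLiu418.K2LiuRankOneSingularLocalValueCMRecord
  (K1Value_localComponent_eq_localScalarK1_cm integral_conjChar_single_mul_weylDelta_eq_of_isGoodPlace)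

namespace Summit.HodgeConjecture.HodgeConjecture.Cruxes.HLiu418.K2LiuRankOneSingularLocalValueCMRecordSplit

open Literature.NumberTheory.Automorphic.IdeleClassGroup (IsConjugateSymplectic toHeckeCharacter)
open Summit.HodgeConjecture.HodgeConjecture.Cruxes.HLiu418.K2LiuSiegelNormaliserTwoOfRecord (splitting_of_record norm_localComponent_of_record)
open Summit.HodgeConjecture.HodgeConjecture.Cruxes.HLiu418.K2LiuSphericalSiegelValueCM (exists_finset_forall_placeLetters_cm exists_finset_forall_record_letters)
open Summit.HodgeConjecture.HodgeConjecture.Cruxes.HLiu418.K2LiuRankOneCornerCharacterReading (exists_adaptedFrame_eq)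

variable (L : Type) [Field L] [NumberField L] [IsCMField L] {N M : ℕ} (e : Fin N × Fin M ≃ Fin 2)
  (dV : Fin N → L) (hdV : ∀ i, IsCMField.complexConj L (dV i) = dV i)
  (dW : Fin M → L) (hdW : ∀ i, IsCMField.complexConj L (dW i) = dW i)
  [∀ v : HeightOneSpectrum (𝓞 (Fp L)), MeasurableSpace ↥(unipDeltaLoc L e dV hdV dW hdW v)]
  [∀ v : HeightOneSpectrum (𝓞 (Fp L)), BorelSpace ↥(unipDeltaLoc L e dV hdV dW hdW v)]

set_option maxHeartbeats 800000 in -- as ★ p863366 §3 (same statement block: the CM telescope under the cofinite binders)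
/-- **(C-a) ★ p863366's VALUE LETTER WITH A TWIST-INDEPENDENT EXCEPTIONAL SET.**  For the doubled CM datum of rank `2` (`hdV0 hdW0`), `lam` conjugate-symplectic and
`χ = toHeckeCharacter L lam⁻¹`: there is ONE finite set `T_rec` of finite places of `L⁺` — ★ `exists_finset_forall_placeLetters_cm` ∪ ★ `exists_finset_forall_record_letters` in the
frame ★ `exists_adaptedFrame_eq`, depending on the datum and `lam` only — such that for EVERY corner parameter `σ` with `τ := t₁·Tr_{L∕L⁺}(σδ) ≠ 0`, every `v ∉ T_rec` at which `τ`
is `v`-integral (`|ι_v τ|_v ≤ 1`), every Haar `ν` on `N_Δ(L⁺_v)` with `ν(K_{H,v} ∩ N_Δ(L⁺_v)) = 1` and every `1 < re s`: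
`∫ conj ψ_{σ E₁₁}(ι_v y)·Λ_{s,v}((w_Δ)_v·y) dν(y) = [(1 − q_v^{−(2s+1)})(1 − ε(ϖ_v) q_v^{−(2s+2)})∕(1 − q_v^{−2s})]·Σ_{k ∈ range (m + 1)}(ε(ϖ_v) q_v^{1−2s})^k`, `m = (−log|ι_v τ|_v).toNat`
— ★ p863366 §3's proof with the `τ`-integrality taken as a hypothesis instead of folded into `T₀(σ)`; so `T₀(σ) ⊆ T_rec ∪ den(τ)` is now VISIBLE.
[cite: KudlaRallis1994, §2] [cite: Shimura1997, §18.4] [cite: Tan1999, §3; §4 Prop. 4.8] [cite: HarrisKudlaSweet1996, §6 (6.14)–(6.16)] -/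
theorem exists_recordFinset_forall_integral_conjChar_lambdaLoc_weylDelta_eq (hdV0 : ∀ i, dV i ≠ 0) (hdW0 : ∀ i, dW i ≠ 0)
    {lam : IdeleClassGroup L →ₜ* Circle} (hlam : IsConjugateSymplectic L lam) :
    ∃ Trec : Finset (HeightOneSpectrum (𝓞 (Fp L))), ∀ (σ : L), gramR L e dV hdV dW hdW 1 1 * Algebra.trace (Fp L) L (σ * imagUnit L) ≠ 0 →
      ∀ v ∉ Trec, Valued.v (algebraMap (Fp L) (v.adicCompletion (Fp L)) (gramR L e dV hdV dW hdW 1 1 * Algebra.trace (Fp L) L (σ * imagUnit L))) ≤ 1 →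
      ∀ (ν : Measure ↥(unipDeltaLoc L e dV hdV dW hdW v)) [ν.IsHaarMeasure],
        ν (((inH (fun v => UnitaryGroup.localInt L (IsCMField.complexConj L) (2 + 2) (hermD L e dV hdV dW hdW) v) (fun v => unipDeltaLoc L e dV hdV dW hdW v) v) :
          Subgroup ↥(unipDeltaLoc L e dV hdV dW hdW v)) : Set ↥(unipDeltaLoc L e dV hdV dW hdW v)) = 1 →
        ∀ s : ℂ, 1 < s.re →
          ∫ y, conj ((unipDeltaChar L e dV hdV dW hdW (Matrix.single 1 1 σ) (locToAdelic L e dV hdV dW hdW v (y : UnitaryGroup.localPi L (IsCMField.complexConj L) (2 + 2) (hermD L e dV hdV dW hdW) v)) : Circle) : ℂ) * LambdaLoc L e dV hdV dW hdW v (toHeckeCharacter L lam⁻¹) s (UnitaryGroup.evalPlace (Fp L) L (IsCMField.complexConj L) (2 + 2) (hermD L e dV hdV dW hdW) v (UnitaryGroup.finPart (Fp L) L (IsCMField.complexConj L) (2 + 2) (hermD L e dV hdV dW hdW) (SiegelDoubled.weylDelta L e dV hdV dW hdW)) * (y : UnitaryGroup.localPi L (IsCMField.complexConj L) (2 + 2)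 (hermD L e dV hdV dW hdW) v)) ∂ν =
            (1 - (v.residueCard : ℂ) ^ (-(2 * s + 1))) * (1 - (quadraticHeckeCharCM L).valueAtUniformizer v * (v.residueCard : ℂ) ^ (-(2 * s + 2))) /
          (1 - (v.residueCard : ℂ) ^ (-(2 * s))) *
          ∑ k ∈ Finset.range ((-WithZero.log (Valued.v (algebraMap (Fp L) (v.adicCompletion (Fp L)) (gramR L e dV hdV dW hdW 1 1 * Algebra.trace (Fp L) L (σ * imagUnit L))))).toNat + 1), ((quadraticHeckeCharCM L).valueAtUniformizer v * (v.residueCard : ℂ) ^ (1 - 2 * s)) ^ k := by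
  classical
  -- the frame of record with its blocks, the place letters, the record letters — all INDEPENDENT of `σ`
  obtain ⟨D, Dinv, Q, hDD, hDD', hQm, hQ, -, hDinv⟩ :=
    exists_adaptedFrame_eq (Fp L) 2 (gramR_isSymm L e dV hdV dW hdW) (isUnit_det_gramR₀ L e dV hdV hdV0 dW hdW hdW0)
  obtain ⟨T₁, hT₁⟩ := exists_finset_forall_placeLetters_cm L e dV hdV dW hdW hdV0 hdW0 (toHeckeCharacter L lam⁻¹) D Dinv
  obtain ⟨T₂, hT₂⟩ := exists_finset_forall_record_letters L (toHeckeCharacter L lam⁻¹)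
  refine ⟨T₁ ∪ T₂, fun σ hτ v hv hτv ν _ hνK s hs => ?_⟩
  rw [Finset.mem_union, not_or] at hv
  obtain ⟨hv₁, hv₂⟩ := hv
  obtain ⟨hgood, hDw, hDiw⟩ := hT₁ v hv₁
  obtain ⟨hχT, hχur, hunr⟩ := hT₂ v hv₂
  have hv1 := integral_conjChar_lambdaLoc_weylDelta_eq_one_of_forall L e dV hdV dW hdW v ν (Matrix.single 1 1 σ) (toHeckeCharacter L lam⁻¹) hχT s
      (fun vol : ℝ => (vol : ℂ) * ((lF (Fp L) L v (fun w : UnitaryGroup.PlacesOver L v => (toHeckeCharacter L lam⁻¹).localComponent w.1) (2 * s + 1) / lF (Fp L) L v (fun w : UnitaryGroup.PlacesOver L v => (toHeckeCharacter L lam⁻¹).localComponent w.1) (2 * s + 2)) * (lEN (Fp L) L (IsCMField.complexConj L) v (fun w : UnitaryGroup.PlacesOver L v => (toHeckeCharacter L lam⁻¹).localComponent w.1) (2 * s) / lEN (Fp L) L (IsCMField.complexConj L) v (fun w : UnitaryGroup.PlacesOver L v => (toHeckeCharacter L lam⁻¹).localComponent w.1) (2 * s + 1)) *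
          ((lF (Fp L) L v (fun w : UnitaryGroup.PlacesOver L v => (toHeckeCharacter L lam⁻¹).localComponent w.1) (2 * s))⁻¹ *
            ∑ k ∈ Finset.range ((-WithZero.log (Valued.v (algebraMap (Fp L) (v.adicCompletion (Fp L)) (gramR L e dV hdV dW hdW 1 1 * Algebra.trace (Fp L) L (σ * imagUnit L))))).toNat + 1), (unramValue (Fp L) v (chiF (Fp L) L v (fun w : UnitaryGroup.PlacesOver L v => (toHeckeCharacter L lam⁻¹).localComponent w.1)) * (residueFieldCard (v.adicCompletion (Fp L)) : ℂ) ^ (1 - 2 * s)) ^ k))) hνK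
      (fun νN _ f hf => integral_conjChar_single_mul_weylDelta_eq_of_isGoodPlace L e dV hdV dW hdW v D Dinv hDD hDD' Q hQm hQ hDinv hDw hDiw
        (toHeckeCharacter L lam⁻¹) (norm_localComponent_of_record L lam v) hgood σ hτ hτv νN hs hf)
  beta_reduce at hv1
  rw [hv1, Complex.ofReal_one, one_mul]
  exact K1Value_localComponent_eq_localScalarK1_cm L v (toHeckeCharacter L lam⁻¹) (splitting_of_record L hlam) hχur hunr
    (Classical.arbitrary (UnitaryGroup.PlacesOver L v)) (zero_lt_one.trans hs) _

end Summit.HodgeConjecture.HodgeConjecture.Cruxes.HLiu418.K2LiuRankOneSingularLocalValueCMRecordSplit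

end
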